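import Summits.CriticalPhenomena.CardyFormulaZ2.Theorems.CardyIKTransportIKLinearTransportScreeningAssemblyDefs
import Summits.CriticalPhenomena.CardyFormulaZ2.Theorems.CardyIKTransportIKLinearTransportScreeningArray

/-!
# `stub_Screening` (crux stmt-CriticalPhenomena-5076, line `pinned-diagram-exchange`) — ANALYSIS sub-goal

The screening error `σ* = sigmaStar (w + 2n - 1) (h + 2n - 1) n θ` of the `(w+2n-1) × (h+2n-1)` internal
plaquette array (landed `screeningArray`) and the offset error `(w + h) θ^n` (landed `screeningOffset`) tend
to `0` uniformly over the box sizes `w, h ≤ 2n`, for `θ = θIK = 7 − 4√3 < 1/8`.  Elementary majorisation of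
the three terms of `σ*` by multiples of `n (8θ)^n`:
* `(1 + θ^n)^{m+k-2n} ≤ (1 + θ^n)^{6n} ≤ exp (6nθ^n) ≤ 1 + 12 n θ^n` (once `6nθ^n ≤ 1`),
* `2^{m+k} θ^m = 2^k (2θ)^m ≤ 2·4^m (2θ)^m = 2 (8θ)^m ≤ 2 (8θ)^n` (as `k ≤ 2m + 1`, `n ≤ m`, `8θ ≤ 1`),
* `2^{m+k+1} θ^{n²} ≤ 2^{8n} θ^{8n} = (2θ)^{8n} ≤ (2θ)^n ≤ (8θ)^n` (for `n ≥ 8`),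
and of the offset by `4 n (8θ)^n`; then `n (8θ)^n → 0` (`tendsto_self_mul_const_pow_of_lt_one`).
-/

noncomputable section

namespace Summit.CriticalPhenomena.CardyFormulaZ2.Theorems.IKLinearTransport.PinnedDiagramExchange.ScreeningAssembly

open ScreeningArray

/-- Term A of `σ*`: `2 ((1 + θ^n)^{m+k-2n} - 1) ≤ 24 n θ^n` when `m + k - 2n ≤ 6n` and `6 n θ^n ≤ 1`
(`1 + x ≤ exp x`, `exp y - 1 ≤ 2 y` for `0 ≤ y ≤ 1`). -/
theorem sigmaStar_termA_le {θ : ℝ} (hθ0 : 0 ≤ θ) {n m k : ℕ} (hmk : m + k - 2 * n ≤ 6 * n)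
    (hsmall : 6 * n * θ ^ n ≤ 1) :
    2 * ((1 + θ ^ n) ^ (m + k - 2 * n) - 1) ≤ 24 * (n * θ ^ n) := by
  have h1 : (1 : ℝ) ≤ 1 + θ ^ n := le_add_of_nonneg_right (by positivity)
  have h2 : (1 + θ ^ n) ^ (m + k - 2 * n) ≤ (1 + θ ^ n) ^ (6 * n) := pow_le_pow_right₀ h1 hmk
  have h3 : (1 + θ ^ n) ^ (6 * n) ≤ Real.exp (6 * n * θ ^ n) := by
    calc (1 + θ ^ n) ^ (6 * n) ≤ (Real.exp (θ ^ n)) ^ (6 * n) :=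
          pow_le_pow_left₀ (by positivity) (by linarith [Real.add_one_le_exp (θ ^ n)]) _
      _ = Real.exp (6 * n * θ ^ n) := by
          rw [← Real.exp_nat_mul]; push_cast; ring_nf
  have hx0 : 0 ≤ 6 * n * θ ^ n := by positivity
  have h4 : Real.exp (6 * n * θ ^ n) - 1 ≤ 2 * (6 * n * θ ^ n) := by
    have habs : |6 * n * θ ^ n| ≤ 1 := by rw [abs_of_nonneg hx0]; exact hsmall
    have := Real.abs_exp_sub_one_le habs
    rw [abs_of_nonneg hx0] at this
    exact le_trans (le_abs_self _) this
  linarith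

/-- One half of term B of `σ*`: `2^k (2θ)^m ≤ 2 (8θ)^n` when `n ≤ m`, `k ≤ 2m + 1`, `0 ≤ θ`, `8θ ≤ 1`. -/
theorem sigmaStar_termB_aux {θ : ℝ} (hθ0 : 0 ≤ θ) (hθ8 : 8 * θ ≤ 1) {n m k : ℕ} (hnm : n ≤ m)
    (hk : k ≤ 2 * m + 1) : (2 : ℝ) ^ k * (2 * θ) ^ m ≤ 2 * (8 * θ) ^ n := by
  have h8 : (8 * θ) ^ m = (4 : ℝ) ^ m * (2 * θ) ^ m := by
    rw [← mul_pow]; congr 1; ring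
  calc (2 : ℝ) ^ k * (2 * θ) ^ m ≤ 2 ^ (2 * m + 1) * (2 * θ) ^ m :=
        mul_le_mul_of_nonneg_right (pow_le_pow_right₀ (by norm_num) hk) (by positivity)
    _ = 2 * (8 * θ) ^ m := by
        rw [h8, pow_succ, pow_mul]; norm_num; ring
    _ ≤ 2 * (8 * θ) ^ n :=
        mul_le_mul_of_nonneg_left (pow_le_pow_of_le_one (by positivity) hθ8 hnm) (by norm_num)

/-- Term B of `σ*`: `2^{m+k} (θ^m + θ^k) ≤ 4 (8θ)^n` for `n ≤ m, k`, `k ≤ 2m+1`, `m ≤ 2k+1`. -/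
theorem sigmaStar_termB_le {θ : ℝ} (hθ0 : 0 ≤ θ) (hθ8 : 8 * θ ≤ 1) {n m k : ℕ} (hnm : n ≤ m)
    (hnk : n ≤ k) (hk : k ≤ 2 * m + 1) (hm : m ≤ 2 * k + 1) :
    (2 : ℝ) ^ (m + k) * (θ ^ m + θ ^ k) ≤ 4 * (8 * θ) ^ n := by
  have hsplit : (2 : ℝ) ^ (m + k) * (θ ^ m + θ ^ k) = 2 ^ k * (2 * θ) ^ m + 2 ^ m * (2 * θ) ^ k := by
    rw [pow_add, mul_pow, mul_pow]; ring
  rw [hsplit]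
  have hBm := sigmaStar_termB_aux hθ0 hθ8 hnm hk
  have hBk := sigmaStar_termB_aux hθ0 hθ8 hnk hm
  linarith

/-- Term C of `σ*`: `2^{m+k+1} θ^{n n} ≤ (8θ)^n` for `n ≥ 8`, `m + k + 1 ≤ 8n`, `0 ≤ θ`, `8θ ≤ 1`. -/
theorem sigmaStar_termC_le {θ : ℝ} (hθ0 : 0 ≤ θ) (hθ8 : 8 * θ ≤ 1) {n m k : ℕ} (hn : 8 ≤ n)
    (hmk : m + k + 1 ≤ 8 * n) : (2 : ℝ) ^ (m + k + 1) * θ ^ (n * n) ≤ (8 * θ) ^ n := by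
  have hθ1 : θ ≤ 1 := by linarith
  have h2θ : 2 * θ ≤ 1 := by linarith
  calc (2 : ℝ) ^ (m + k + 1) * θ ^ (n * n) ≤ 2 ^ (8 * n) * θ ^ (8 * n) :=
        mul_le_mul (pow_le_pow_right₀ (by norm_num) hmk)
          (pow_le_pow_of_le_one hθ0 hθ1 (Nat.mul_le_mul_right n hn)) (by positivity) (by positivity)
    _ = (2 * θ) ^ (8 * n) := (mul_pow _ _ _).symm
    _ ≤ (2 * θ) ^ n := pow_le_pow_of_le_one (by positivity) h2θ (Nat.le_mul_of_pos_left n (by norm_num))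
    _ ≤ (8 * θ) ^ n := pow_le_pow_left₀ (by positivity) (by linarith) n

/-- Pointwise majorant: for `0 ≤ θ`, `8θ ≤ 1`, `n ≥ 8`, `2n ≤ m + 1 ≤ 4n`, `2n ≤ k + 1 ≤ 4n` and
`6 n θ^n ≤ 1`, `σ*(m, k, n, θ) ≤ 29 · n (8θ)^n`. -/
theorem sigmaStar_le_majorant {θ : ℝ} (hθ0 : 0 ≤ θ) (hθ8 : 8 * θ ≤ 1) {n m k : ℕ} (hn : 8 ≤ n)
    (hm1 : 2 * n ≤ m + 1) (hm2 : m + 1 ≤ 4 * n) (hk1 : 2 * n ≤ k + 1) (hk2 : k + 1 ≤ 4 * n)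
    (hsmall : 6 * n * θ ^ n ≤ 1) : sigmaStar m k n θ ≤ 29 * (n * (8 * θ) ^ n) := by
  have hA := sigmaStar_termA_le hθ0 (m := m) (k := k) (n := n) (by omega) hsmall
  have hB := sigmaStar_termB_le hθ0 hθ8 (n := n) (m := m) (k := k) (by omega) (by omega) (by omega)
    (by omega)
  have hC := sigmaStar_termC_le hθ0 hθ8 (m := m) (k := k) hn (by omega)
  have hθn : θ ^ n ≤ (8 * θ) ^ n := pow_le_pow_left₀ hθ0 (by linarith) n
  have hnθ : (n : ℝ) * θ ^ n ≤ n * (8 * θ) ^ n := mul_le_mul_of_nonneg_left hθn (by positivity)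
  have hone : (1 : ℝ) ≤ n := by exact_mod_cast (le_trans (by norm_num) hn : 1 ≤ n)
  have hpow1 : (8 * θ) ^ n ≤ n * (8 * θ) ^ n := le_mul_of_one_le_left (by positivity) hone
  unfold sigmaStar
  linarith

/-- SUB-GOAL · the screening error tends to zero: for every `ε > 0`, from some `N ≥ 1` on,
`σ* ≤ 1` and `2σ* + (w + h) θ^n ≤ ε` for all `w, h ≤ 2n` (`θ = 7 − 4√3`, array `(w+2n−1) × (h+2n−1)`). [folklore] -/
theorem screening_error_small : ∀ ε : ℝ, 0 < ε → ∃ N : ℕ, 1 ≤ N ∧ ∀ n : ℕ, N ≤ n → ∀ w h : ℕ, w ≤ 2 * n → h ≤ 2 * n → sigmaStar (w + 2 * n - 1) (h + 2 * n - 1) n θIK ≤ 1 ∧ 2 * sigmaStar (w + 2 * n - 1) (h + 2 * n - 1) n θIK + (w + h) * θIK ^ n ≤ ε := by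
  intro ε hε
  obtain ⟨hθ0, -, hθ8⟩ := θIK_bounds
  have hθ8' : 8 * θIK ≤ 1 := by linarith
  -- the rate `u n = n (8θ)^n → 0`
  have hu : Filter.Tendsto (fun n : ℕ => (n : ℝ) * (8 * θIK) ^ n) Filter.atTop (nhds 0) :=
    tendsto_self_mul_const_pow_of_lt_one (by positivity) (by linarith)
  have hδ : (0 : ℝ) < min ε 1 / 62 := by positivity
  obtain ⟨N₀, hN₀⟩ := Filter.eventually_atTop.1 (hu.eventually_lt_const hδ)
  refine ⟨max N₀ 8, le_trans (by norm_num) (le_max_right _ _), fun n hn w h hw hh => ?_⟩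
  have hn8 : 8 ≤ n := le_trans (le_max_right _ _) hn
  have hun : (n : ℝ) * (8 * θIK) ^ n < min ε 1 / 62 := hN₀ n (le_trans (le_max_left _ _) hn)
  have hmin1 : min ε 1 ≤ 1 := min_le_right _ _
  have hminε : min ε 1 ≤ ε := min_le_left _ _
  have hθn : θIK ^ n ≤ (8 * θIK) ^ n := pow_le_pow_left₀ hθ0 (by linarith) n
  have hnθ : (n : ℝ) * θIK ^ n ≤ n * (8 * θIK) ^ n := mul_le_mul_of_nonneg_left hθn (by positivity)
  have hsmall : 6 * n * θIK ^ n ≤ 1 := by nlinarith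
  have hσ : sigmaStar (w + 2 * n - 1) (h + 2 * n - 1) n θIK ≤ 29 * (n * (8 * θIK) ^ n) :=
    sigmaStar_le_majorant hθ0 hθ8' hn8 (by omega) (by omega) (by omega) (by omega) hsmall
  have hw' : (w : ℝ) ≤ 2 * n := by exact_mod_cast hw
  have hh' : (h : ℝ) ≤ 2 * n := by exact_mod_cast hh
  have hoff : ((w : ℝ) + h) * θIK ^ n ≤ 4 * (n * (8 * θIK) ^ n) := by
    calc ((w : ℝ) + h) * θIK ^ n ≤ (4 * n) * (8 * θIK) ^ n :=
          mul_le_mul (by linarith) hθn (by positivity) (by positivity)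
      _ = 4 * (n * (8 * θIK) ^ n) := by ring
  constructor
  · nlinarith
  · nlinarith

end Summit.CriticalPhenomena.CardyFormulaZ2.Theorems.IKLinearTransport.PinnedDiagramExchange.ScreeningAssembly
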